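import Summits.BirchSwinnertonDyer.BirchSwinnertonDyer.Theorems.SignedLowerHalvesKobayashiLowerHalfSemistableDefmuTorsionImageTower
import HarnessLib

/-!
# The two-step kernels `ker(Pic(𝒪_{p^{k+3}}) → Pic(𝒪_{p^{k+1}}))` are cyclic for EVERY prime `p` once `p ≠ 2 ∨ k ≥ 1`;
# order growth and `Δ ∩ ker = 1` in the same generality

Route-independent `Theorems` file (cell `b2b-bsdres`, seat `b2b-bsdres-x10b`, gen 45), part 11 of the series «tower square root»
serving crux `DerivedHeightCap` (stmt-BirchSwinnertonDyer-18438, route DefiniteTheta), registered stub `stub_towerSqrt`.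
HONEST FRAMING: no curve asserted, no class closed, BSD not proved by any of this.

Parts 5–10 (gen 44) and the `torsionImage` files of gen 43 describe the layer structure of `G̃_m = Pic(𝒪_{p^m})` modulo the image
`Δ_m = torsionImage K p m` of the torsion of `G̃_∞` for `K` imaginary quadratic and `p` ODD. The only place where `p ≠ 2` enters
is Cox's kernel computation at the bottom: for `c = p^{k+1}` and `v = 1 + cω` one has `v^p = X + cpY₁ω` with `p ∤ Y₁` — true for
odd `p`, and for `p = 2` exactly when `4 ∣ c` (or `t = ω + ω̄` is even): at `p = 2`, `c = 2`, `t` odd the two-step kernel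
`ker(Pic(𝒪_8) → Pic(𝒪_2)) ≅ (ℤ/2)²` is NOT cyclic (e.g. `K = ℚ(√-3)`: `(1 + 2ζ₃)² = -3 ∈ ℤ`), and the torsion of `G̃_∞` need not
inject into `Pic(𝒪_2)`; one level higher everything is as for odd `p` (`1 + 4𝒪_K ⊗ ℤ₂` is torsion-free).
This file re-proves §3–§6 of the gen-43 files under the uniform hypothesis **`p ≠ 2 ∨ 1 ≤ k`** (same level arithmetic):

* §1 `one_add_mul_omega_pow_prime_coords`: `(1 + cω)^p = X + cpY₁ω`, `p ∤ Y₁`, for `p ∣ c` and `p ≠ 2 ∨ 4 ∣ c`.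
* §2 `exists_picRes_eq_one_and_pow_ne_one_of_ne_two_or`: an element of order `p²` in `ker(Pic(𝒪_{p^{k+3}}) → Pic(𝒪_{p^{k+1}}))`.
* §3 `pow_prime_ne_one_of_picRes_of_ne_two_or`, `pow_pow_ne_one_of_picRes_of_ne_two_or`: order growth along the tower.
* §4 `eq_one_of_mem_torsionImage_of_picRes_eq_one_of_ne_two_or`: `Δ_{k+2} ∩ ker(→ Pic(𝒪_{p^{k+1}})) = 1`.

## References
* [Cox2013] D. A. Cox, *Primes of the form x² + ny²*, 2nd ed., §7.D Thm. 7.24, (7.25)–(7.27).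
* [BertoliniDarmon2005] §1.2 (18)–(21); [DarmonIovita2008] §2.2.
-/

noncomputable section

open scoped BigOperators

-- D-0017: single-problem summit, the namespace repeats the problem name by design.
set_option linter.dupNamespace false

namespace Summit.BirchSwinnertonDyer.BirchSwinnertonDyer.Theorems.TowerSqrt

open Literature.NumberTheory.EllipticCurves Literature.NumberTheory.EllipticCurves.QuadOrderTower
  Literature.NumberTheory.QuadraticFields.Quadratic NumberField Module
open Summit.BirchSwinnertonDyer.BirchSwinnertonDyer.Theorems.DefmuSupersingularTheta
  (natCard_ker_picRes pow_eq_one_of_picRes_eq_one picRes_mem_torsionImage)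

universe u

variable {K : Type u} [Field K] [NumberField K] (p : ℕ) [hp : Fact p.Prime]

/-! ### §1 Coordinates of `(1 + cω)^p` -/

omit [NumberField K] hp in
/-- `ω² = m + tω` in `K` (`m = mConst b`, `t = tConst b`). [cite: Cox2013, §7.A Lemma 7.2] -/
theorem omega_mul_omega_eq (b : Basis (Fin 2) ℤ (𝓞 K)) (hb : b 0 = 1) :
    omega b * omega b = (mConst b : K) + (tConst b : K) * omega b := by
  have h' := congrArg (algebraMap (𝓞 K) K) (basis_one_mul_self_eq b hb)
  simpa [omega, mConst, tConst] using h'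

omit [NumberField K] hp in
/-- Coordinates of `(1 + cω)^j = X_j + c y_j ω`: `c² ∣ X_j − 1` and `y_j ≡ j + ct·T_j (mod cp)` with `2T_j = j(j−1)`
(`p ∣ c`). [folklore] -/
theorem one_add_mul_omega_pow_coords (b : Basis (Fin 2) ℤ (𝓞 K)) (hb : b 0 = 1) (c : ℕ) (hpc : (p : ℤ) ∣ c)
    (j : ℕ) : ∃ X y T : ℤ, (1 + (c : K) * omega b) ^ j = (X : K) + ((c * y : ℤ) : K) * omega b ∧
      ((c : ℤ) * c ∣ X - 1) ∧ ((c : ℤ) * p ∣ y - (j + c * tConst b * T)) ∧ 2 * T = (j : ℤ) * ((j : ℤ) - 1) := by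
  induction j with
  | zero => exact ⟨1, 0, 0, by simp, by simp, by simp, by simp⟩
  | succ j ih =>
    obtain ⟨X, y, T, hpow, hX, hy, hT⟩ := ih
    have hω := omega_mul_omega_eq b hb
    refine ⟨X + c * c * y * mConst b, X + y + c * y * tConst b, T + j, ?_, ?_, ?_, ?_⟩
    · rw [pow_succ, hpow]
      push_cast
      linear_combination ((c : K) * (c : K) * (y : K)) * hω
    · have e : X + c * c * y * mConst b - 1 = (X - 1) + c * c * (y * mConst b) := by ring
      rw [e]
      exact dvd_add hX (dvd_mul_right _ _)
    · have hcp_cc : (c : ℤ) * p ∣ (c : ℤ) * c := mul_dvd_mul_left _ hpc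
      have e : X + y + c * y * tConst b - ((((j + 1 : ℕ) : ℤ)) + c * tConst b * (T + j)) =
          (X - 1) + (y - (j + c * tConst b * T)) * (1 + c * tConst b) +
            c * c * (tConst b * tConst b * T) := by
        push_cast; ring
      rw [e]
      exact dvd_add (dvd_add (hcp_cc.trans hX) (hy.mul_right _)) (hcp_cc.trans (dvd_mul_right _ _))
    · push_cast
      linear_combination hT

omit [NumberField K] in
/-- **`(1 + cω)^p = X + cpY₁ω` with `p ∤ Y₁`** for `p ∣ c` and (`p` odd or `4 ∣ c`): `y_p ≡ p + ct·T (mod cp)` with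
`2T = p(p−1)`, and `p² ∣ cT` (for odd `p`: `p ∣ T`; for `p = 2`: `T = 1`, `4 ∣ c`). At `p = 2`, `c ≡ 2 (mod 4)`, `t` odd this
fails (`Y₁` is even). [folklore] -/
theorem one_add_mul_omega_pow_prime_coords (b : Basis (Fin 2) ℤ (𝓞 K)) (hb : b 0 = 1) (c : ℕ)
    (hpc : (p : ℤ) ∣ c) (h4 : p ≠ 2 ∨ (4 : ℤ) ∣ c) :
    ∃ X Y₁ : ℤ, (1 + (c : K) * omega b) ^ p = (X : K) + ((c * p * Y₁ : ℤ) : K) * omega b ∧ ¬ (p : ℤ) ∣ Y₁ := by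
  obtain ⟨X, y, T, hpow, -, hy, hT⟩ := one_add_mul_omega_pow_coords p b hb c hpc p
  have hprime : Prime (p : ℤ) := Nat.prime_iff_prime_int.mp hp.out
  -- for odd `p`, `p ∣ T = p(p-1)/2`
  have hpT_of_ne : p ≠ 2 → (p : ℤ) ∣ T := fun hp2 => by
    have h2 : (p : ℤ) ∣ 2 * T := ⟨(p : ℤ) - 1, by rw [hT]⟩
    rcases hprime.dvd_or_dvd h2 with h | h
    · exfalso
      have h' : p ∣ 2 := by exact_mod_cast h
      exact hp2 ((Nat.prime_dvd_prime_iff_eq hp.out Nat.prime_two).mp h')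
    · exact h
  -- `p² ∣ c T`
  have hcT : (p : ℤ) * p ∣ (c : ℤ) * T := by
    by_cases hp2 : p = 2
    · rcases h4 with h | h4c
      · exact absurd hp2 h
      · subst hp2
        have hT1 : T = 1 := by push_cast at hT; linarith
        have h22 : ((2 : ℕ) : ℤ) * ((2 : ℕ) : ℤ) = 4 := by norm_num
        rw [hT1, mul_one, h22]
        exact h4c
    · exact mul_dvd_mul hpc (hpT_of_ne hp2)
  obtain ⟨S, hS⟩ := hcT
  obtain ⟨w, hw⟩ := hy
  -- `y = p (1 + p S t + c w)`
  have hy' : y = p * (1 + p * S * tConst b + c * w) := by linear_combination hw + (tConst b) * hS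
  refine ⟨X, 1 + p * S * tConst b + c * w, ?_, ?_⟩
  · rw [hpow, hy']
    congr 2
    push_cast
    ring
  · rintro ⟨z, hz⟩
    have h1 : (p : ℤ) ∣ 1 := by
      refine ⟨z - S * tConst b - w * (c / p : ℤ), ?_⟩
      obtain ⟨c', hc'⟩ := hpc
      have hp0 : (p : ℤ) ≠ 0 := by exact_mod_cast hp.out.ne_zero
      rw [hc', Int.mul_ediv_cancel_left _ hp0]
      linear_combination hz - w * hc'
    exact hp.out.not_dvd_one (by exact_mod_cast h1)

/-! ### §2 An element of order `p²` in the two-step kernel -/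

/-- `𝔞_v^j = 𝔞_{v^j}` for Cox's kernel ideals `𝔞_v = v𝒪_d + ℓ𝒪_c` with `N(v) = v v'` prime to `ℓ` (iterated
multiplicativity `kerFrac_sub_one_mul_kerFrac_sub_one_eq`). [cite: Cox2013, §7.D Thm. 7.24 (7.25)–(7.27)] -/
theorem kerFrac_sub_one_pow_eq {c d : ℕ} [NeZero d] {ℓ : ℕ} (hd : d = c * ℓ) {v v' : K}
    (hv : v ∈ quadOrder K c) (hv' : v' ∈ quadOrder K c) {n : ℤ} (hvv' : v * v' = n) (hn : IsCoprime n ℓ)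
    (j : ℕ) : kerFrac (Dvd.intro ℓ hd.symm) ℓ (v - 1) ^ j = kerFrac (Dvd.intro ℓ hd.symm) ℓ (v ^ j - 1) := by
  induction j with
  | zero => rw [pow_zero, pow_zero, kerFrac_one_sub_one_eq_one hd]
  | succ j ih =>
    rw [pow_succ, ih, pow_succ]
    refine kerFrac_sub_one_mul_kerFrac_sub_one_eq hd (Subalgebra.pow_mem _ hv j) (Subalgebra.pow_mem _ hv' j) hv
      (n := n ^ j) ?_ (hn.pow_left)
    rw [← mul_pow, hvv', Int.cast_pow]

/-- **An element of order `p²` in `ker(Pic(𝒪_{p^{k+3}}) → Pic(𝒪_{p^{k+1}}))`** for `K` imaginary quadratic and EVERY prime `p`,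
provided `p ≠ 2 ∨ 1 ≤ k` (at `p = 2` the base level must be `≥ 2`, i.e. `4 ∣ c = 2^{k+1}`): the class `g₀` of Cox's invertible ideal
`𝔞_v = v𝒪_{cp²} + p²𝒪_c`, `v = 1 + cω`, `c = p^{k+1}`, restricts to `1` in `Pic(𝒪_c)` and has `g₀^p = [𝔞_{v^p}] ≠ 1` (`v^p = X + cpY₁ω`,
`p ∤ Y₁`, §1; `1 = (U + Vω) v^p + p²(R + Sω)` with `cp² ∣ V`, `c ∣ S` is impossible). [cite: Cox2013, §7.D Thm. 7.24 (7.25)–(7.27)]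
[cite: DarmonIovita2008, §2.2] -/
theorem exists_picRes_eq_one_and_pow_ne_one_of_ne_two_or (hK : IsImaginaryQuadratic K) (k : ℕ) (hpk : p ≠ 2 ∨ 1 ≤ k) :
    ∃ g₀ : ClassGroup (quadOrder K (p ^ (k + 3))),
      picRes K (pow_dvd_pow p (by omega : k + 1 ≤ k + 3)) g₀ = 1 ∧ g₀ ^ p ≠ 1 := by
  classical
  obtain ⟨b, hb⟩ := exists_basis_zero_eq_one (K := K) hK.1
  set c : ℕ := p ^ (k + 1) with hc
  have hd : p ^ (k + 3) = c * p ^ 2 := by rw [hc, ← pow_add]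
  have hpcN : p ∣ c := by rw [hc]; exact dvd_pow_self p k.succ_ne_zero
  have hpc : (p : ℤ) ∣ (c : ℤ) := by exact_mod_cast hpcN
  have h4 : p ≠ 2 ∨ (4 : ℤ) ∣ c := by
    rcases hpk with h | h
    · exact Or.inl h
    · by_cases hp2 : p = 2
      · right
        have : (4 : ℕ) ∣ c := by
          rw [hc, hp2, show (4 : ℕ) = 2 ^ 2 by norm_num]
          exact pow_dvd_pow 2 (by omega)
        exact_mod_cast this
      · exact Or.inl hp2
  have hc2 : 2 ≤ c := le_trans hp.out.two_le (Nat.le_of_dvd (NeZero.pos c) hpcN)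
  have hω := omega_mul_omega_eq b hb
  -- `v = 1 + cω`, `v' = (1 + ct) − cω`, `v v' = n = 1 + ct − c²m`
  have hv : (1 : K) + (c : K) * omega b ∈ quadOrder K c := by
    have := coords_mem_quadOrder b hb (K := K) (c := c) (X := 1) (Y := c) (dvd_refl _)
    simpa using this
  have hv' : (((1 + c * tConst b : ℤ)) : K) + ((-(c : ℤ) : ℤ) : K) * omega b ∈ quadOrder K c :=
    coords_mem_quadOrder b hb (dvd_neg.mpr (dvd_refl _))
  have hvv' : ((1 : K) + (c : K) * omega b) *
      ((((1 + c * tConst b : ℤ)) : K) + ((-(c : ℤ) : ℤ) : K) * omega b) =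
        ((1 + c * tConst b - c * c * mConst b : ℤ) : K) := by
    push_cast
    linear_combination (-((c : K) * (c : K))) * hω
  have hn : IsCoprime (1 + c * tConst b - c * c * mConst b : ℤ) ((p ^ 2 : ℕ) : ℤ) := by
    obtain ⟨c', hc'⟩ := hpc
    have h1 : IsCoprime (1 + c * tConst b - c * c * mConst b : ℤ) (p : ℤ) := by
      refine ⟨1, -(c' * tConst b - c' * c * mConst b), ?_⟩
      linear_combination (tConst b - c * mConst b) * hc'
    push_cast
    exact h1.pow_right
  let 𝔟 := kerUnitOf hd hv hv' hvv' hn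
  refine ⟨ClassGroup.mk K 𝔟, ?_, fun hpow1 => ?_⟩
  · exact picRes_mk_kerUnitOf hd hv hv' hvv' hn
  -- `g₀^p = [𝔞_{v^p}]`
  obtain ⟨X, Y₁, hvp, hY₁⟩ := one_add_mul_omega_pow_prime_coords p b hb c hpc h4
  have hvp_mem : ((1 : K) + (c : K) * omega b) ^ p ∈ quadOrder K c := Subalgebra.pow_mem _ hv p
  have hv'p_mem : ((((1 + c * tConst b : ℤ)) : K) + ((-(c : ℤ) : ℤ) : K) * omega b) ^ p ∈ quadOrder K c :=
    Subalgebra.pow_mem _ hv' p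
  have hvv'p : ((1 : K) + (c : K) * omega b) ^ p *
      ((((1 + c * tConst b : ℤ)) : K) + ((-(c : ℤ) : ℤ) : K) * omega b) ^ p =
        (((1 + c * tConst b - c * c * mConst b) ^ p : ℤ) : K) := by
    rw [← mul_pow, hvv', Int.cast_pow]
  have hnp : IsCoprime ((1 + c * tConst b - c * c * mConst b) ^ p : ℤ) ((p ^ 2 : ℕ) : ℤ) := hn.pow_left
  have hunit_eq : 𝔟 ^ p = kerUnitOf hd hvp_mem hv'p_mem hvv'p hnp := by
    refine Units.ext ?_
    rw [Units.val_pow_eq_pow_val, coe_kerUnitOf, coe_kerUnitOf]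
    exact kerFrac_sub_one_pow_eq hd hv hv' hvv' hn p
  -- the trivial class `[𝔞_1] = 1`
  have h1u : ClassGroup.mk K (kerUnitOf hd (v := (1 : K)) (v' := 1) (n := 1) (Subalgebra.one_mem _)
      (Subalgebra.one_mem _) (by simp) (isCoprime_one_left)) = 1 := by
    rw [ClassGroup.mk_eq_one_iff, FractionalIdeal.isPrincipal_iff]
    exact ⟨1, by rw [FractionalIdeal.spanSingleton_one, coe_kerUnitOf, kerFrac_one_sub_one_eq_one hd]⟩
  have hmk : ClassGroup.mk K (kerUnitOf hd hvp_mem hv'p_mem hvv'p hnp) =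
      ClassGroup.mk K (kerUnitOf hd (v := (1 : K)) (v' := 1) (n := 1) (Subalgebra.one_mem _)
        (Subalgebra.one_mem _) (by simp) (isCoprime_one_left)) := by
    rw [← hunit_eq, map_pow, hpow1, h1u]
  have hunits := coe_units_quadOrder_eq_one_or_eq_neg_one hK hc2
  have hmem := mem_of_mk_kerUnitOf_eq hunits hd hvp_mem hv'p_mem hvv'p hnp (Subalgebra.one_mem _)
    (Subalgebra.one_mem _) (by simp) isCoprime_one_left hmk
  -- `1 = u v^p + p² r`, `u ∈ 𝒪_{cp²}`, `r ∈ 𝒪_c`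
  rw [mem_kerFrac_sub_one_iff] at hmem
  obtain ⟨u, hu, r, hr, h1⟩ := hmem
  rw [hvp] at h1
  obtain ⟨U, V, hV, rfl⟩ := (mem_quadOrder_iff_coords b hb).mp hu
  obtain ⟨R, S, hS, rfl⟩ := (mem_quadOrder_iff_coords b hb).mp hr
  have hfinal : (((1 : ℤ)) : K) + (((0 : ℤ)) : K) * omega b =
      ((U * X + V * (c * p * Y₁) * mConst b + (p : ℤ) ^ 2 * R : ℤ) : K) +
        ((U * (c * p * Y₁) + V * X + V * (c * p * Y₁) * tConst b + (p : ℤ) ^ 2 * S : ℤ) : K) * omega b := by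
    push_cast at h1 ⊢
    linear_combination h1 + ((V : K) * ((c : K) * (p : K) * (Y₁ : K))) * hω
  obtain ⟨h0, hω1⟩ := coords_unique b hb hfinal
  -- `cp² ∣ V`, `c ∣ S`
  rw [hd] at hV
  obtain ⟨V', rfl⟩ := hV
  obtain ⟨S', rfl⟩ := hS
  have hc0 : (c : ℤ) ≠ 0 := by exact_mod_cast (NeZero.ne c)
  -- `ω`-coordinate divided by `c`: `U Y₁ = −p (...)`, so `p ∣ U`
  have hω2 : U * Y₁ = -(p : ℤ) * (V' * X + (c : ℤ) * (p : ℤ) * V' * Y₁ * tConst b + S') := by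
    have h3 : (c : ℤ) * (p * (U * Y₁ + (p : ℤ) * (V' * X + (c : ℤ) * (p : ℤ) * V' * Y₁ * tConst b + S'))) = 0 := by
      push_cast at hω1
      linear_combination -hω1
    have h4 : U * Y₁ + (p : ℤ) * (V' * X + (c : ℤ) * (p : ℤ) * V' * Y₁ * tConst b + S') = 0 := by
      have hp0 : (p : ℤ) ≠ 0 := by exact_mod_cast hp.out.ne_zero
      rcases mul_eq_zero.mp h3 with h | h
      · exact absurd h hc0
      · rcases mul_eq_zero.mp h with h' | h'
        · exact absurd h' hp0
        · exact h'
    linear_combination h4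
  have hprime : Prime (p : ℤ) := Nat.prime_iff_prime_int.mp hp.out
  have hpU : (p : ℤ) ∣ U := by
    have : (p : ℤ) ∣ U * Y₁ := ⟨-(V' * X + (c : ℤ) * (p : ℤ) * V' * Y₁ * tConst b + S'), by rw [hω2]; ring⟩
    rcases hprime.dvd_or_dvd this with h | h
    · exact h
    · exact absurd h hY₁
  obtain ⟨U', rfl⟩ := hpU
  -- constant coordinate: `1 = p(…)`
  have h1' : (p : ℤ) ∣ 1 :=
    ⟨U' * X + (c : ℤ) * (p : ℤ) ^ 2 * V' * (c * Y₁) * mConst b + (p : ℤ) * R, by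
      push_cast at h0 ⊢; linear_combination h0⟩
  exact hp.out.not_dvd_one (by exact_mod_cast h1')

/-! ### §3 Order growth -/

/-- **`ker(Pic(𝒪_{p^{k+3}}) → Pic(𝒪_{p^{k+1}}))` is cyclic of order `p²`** (every prime `p`, `p ≠ 2 ∨ 1 ≤ k`), in the form: every
element of it NOT in `ker(→ Pic(𝒪_{p^{k+2}}))` has `g^p ≠ 1`. [cite: Cox2013, §7.D Thm. 7.24 (7.25)–(7.27)] [cite: DarmonIovita2008, §2.2] -/
theorem pow_prime_ne_one_of_picRes_of_ne_two_or (hK : IsImaginaryQuadratic K) (k : ℕ) (hpk : p ≠ 2 ∨ 1 ≤ k)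
    {g : ClassGroup (quadOrder K (p ^ (k + 3)))}
    (h1 : picRes K (pow_dvd_pow p (by omega : k + 1 ≤ k + 3)) g = 1)
    (h2 : picRes K (pow_dvd_pow p (by omega : k + 2 ≤ k + 3)) g ≠ 1) : g ^ p ≠ 1 := by
  obtain ⟨g₀, hg₀1, hg₀p⟩ := exists_picRes_eq_one_and_pow_ne_one_of_ne_two_or p hK k hpk
  set π32 := picRes K (pow_dvd_pow p (by omega : k + 2 ≤ k + 3)) with hπ32
  set π21 := picRes K (pow_dvd_pow p (k + 1).le_succ) with hπ21
  have hκ : π21 (π32 g) = 1 := by rw [hπ21, hπ32, picRes_picRes]; exact h1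
  have hκ₀ : π21 (π32 g₀) = 1 := by rw [hπ21, hπ32, picRes_picRes]; exact hg₀1
  -- the one-step kernel `ker π21` has prime order `p` and is generated by `π32 g ≠ 1`
  have hcardH : Nat.card π21.ker = p := natCard_ker_picRes p hK k
  have hne : (⟨π32 g, hκ⟩ : π21.ker) ≠ 1 := fun h => h2 (congrArg Subtype.val h)
  have htop := zpowers_eq_top_of_prime_card hcardH hne
  have hmem : (⟨π32 g₀, hκ₀⟩ : π21.ker) ∈ Subgroup.zpowers (⟨π32 g, hκ⟩ : π21.ker) := by
    rw [htop]; exact Subgroup.mem_top _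
  obtain ⟨i, hi⟩ := Subgroup.mem_zpowers_iff.mp hmem
  have hi' : π32 g ^ i = π32 g₀ := by
    have := congrArg Subtype.val hi
    simpa using this
  -- `q = g₀ (g^i)⁻¹ ∈ ker π32` is killed by `p`
  have hq : π32 (g₀ * (g ^ i)⁻¹) = 1 := by rw [map_mul, map_inv, map_zpow, hi', mul_inv_cancel]
  have hqp : (g₀ * (g ^ i)⁻¹) ^ p = 1 := pow_eq_one_of_picRes_eq_one p hK (k + 1) hq
  intro hgp
  apply hg₀p
  calc g₀ ^ p = (g₀ * (g ^ i)⁻¹) ^ p * (g ^ i) ^ p := by rw [← mul_pow, inv_mul_cancel_right]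
    _ = 1 := by rw [hqp, one_mul, ← zpow_natCast (g ^ i), ← zpow_mul, mul_comm, zpow_mul, zpow_natCast, hgp,
        one_zpow]

/-- **Order growth** (every prime `p`, `p ≠ 2 ∨ 1 ≤ k`): an element of `ker(Pic(𝒪_{p^{M}}) → Pic(𝒪_{p^{k+1}}))`, `M = k + 2 + j`,
NOT in `ker(→ Pic(𝒪_{p^{k+2}}))` satisfies `g^{p^j} ≠ 1`. [cite: DarmonIovita2008, §2.2] [cite: Cox2013, §7.D Thm. 7.24] -/
theorem pow_pow_ne_one_of_picRes_of_ne_two_or (hK : IsImaginaryQuadratic K) (j : ℕ) :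
    ∀ (k : ℕ) (_ : p ≠ 2 ∨ 1 ≤ k) (M : ℕ) (hM : M = k + 2 + j) (g : ClassGroup (quadOrder K (p ^ M))),
      picRes K (pow_dvd_pow p (by omega : k + 1 ≤ M)) g = 1 →
      picRes K (pow_dvd_pow p (by omega : k + 2 ≤ M)) g ≠ 1 → g ^ p ^ j ≠ 1 := by
  induction j with
  | zero =>
    intro k _ M hM g _ h2 hg
    rw [pow_zero, pow_one] at hg
    exact h2 (by rw [hg, map_one])
  | succ j ih =>
    intro k hpk M hM g h1 h2 hgp
    rw [pow_succ', pow_mul] at hgp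
    have hM' : M = (k + 1) + 2 + j := by omega
    refine ih (k + 1) (Or.inr (by omega)) M hM' (g ^ p) ?_ ?_ hgp
    · rw [map_pow]
      apply pow_eq_one_of_picRes_eq_one p hK k
      rw [picRes_picRes]; exact h1
    · rw [map_pow]
      apply pow_prime_ne_one_of_picRes_of_ne_two_or p hK k hpk
      · rw [picRes_picRes]; exact h1
      · rw [picRes_picRes]; exact h2

/-! ### §4 `Δ ∩ ker = 1` above the base level -/

/-- **`Δ ↪ G̃_{k+1}`** (every prime `p`, `p ≠ 2 ∨ 1 ≤ k`): a class of `torsionImage (k+2)` restricting to `1` in `Pic(𝒪_{p^{k+1}})`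
is `1`. [cite: DarmonIovita2008, §2.2] [cite: BertoliniDarmon2005, §1.2 (21)] -/
theorem eq_one_of_mem_torsionImage_of_picRes_eq_one_of_ne_two_or (hK : IsImaginaryQuadratic K) (k : ℕ) (hpk : p ≠ 2 ∨ 1 ≤ k)
    {κ : ClassGroup (quadOrder K (p ^ (k + 2)))} (hκ : κ ∈ torsionImage K p (k + 2))
    (h1 : picRes K (pow_dvd_pow p (k + 1).le_succ) κ = 1) : κ = 1 := by
  by_contra hne
  obtain ⟨e, he, hlift⟩ := hκ
  obtain ⟨a, e', he', rfl⟩ := Nat.exists_eq_pow_mul_and_not_dvd he.ne' p hp.out.ne_one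
  obtain ⟨g', hg'e, hg'⟩ := hlift (k + 2 + a) (by omega)
  have hκp : κ ^ p = 1 := pow_eq_one_of_picRes_eq_one p hK k h1
  have hκe' : κ ^ e' ≠ 1 := by
    intro h
    have hdvd : orderOf κ ∣ Nat.gcd e' p :=
      Nat.dvd_gcd (orderOf_dvd_of_pow_eq_one h) (orderOf_dvd_of_pow_eq_one hκp)
    have hcop : Nat.Coprime e' p := (Nat.coprime_comm.mp (hp.out.coprime_iff_not_dvd.mpr he'))
    rw [hcop] at hdvd
    exact hne (orderOf_eq_one_iff.mp (Nat.dvd_one.mp hdvd))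
  have H1 : picRes K (pow_dvd_pow p (by omega : k + 1 ≤ k + 2 + a)) (g' ^ e') = 1 := by
    have h : picRes K (pow_dvd_pow p (k + 1).le_succ)
        (picRes K (pow_dvd_pow p (by omega : k + 2 ≤ k + 2 + a)) (g' ^ e')) = 1 := by
      rw [map_pow, hg', map_pow, h1, one_pow]
    rwa [picRes_picRes] at h
  have H2 : picRes K (pow_dvd_pow p (by omega : k + 2 ≤ k + 2 + a)) (g' ^ e') ≠ 1 := by
    rw [map_pow, hg']; exact hκe'
  have H3 : (g' ^ e') ^ p ^ a = 1 := by rw [← pow_mul, mul_comm, hg'e]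
  exact pow_pow_ne_one_of_picRes_of_ne_two_or p hK a k hpk (k + 2 + a) rfl (g' ^ e') H1 H2 H3

end Summit.BirchSwinnertonDyer.BirchSwinnertonDyer.Theorems.TowerSqrt

end
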